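import Summits.CriticalPhenomena.PercolationContinuityZ3.Theorems.PercLowPointHalfSpaceTallClusterMassBoundArrowOneVolRad

/-!
# `TallClusterMassBound` (stmt-CriticalPhenomena-0912), line `SketchIdeator4` — ARROW 1 at ANY threshold
# `t ≥ typicalMax`, and B from a `typicalMax`-free wall volume/radius inequality

Helper stubs of the skeleton `Cruxes/TallClusterMassBound/Lines/SketchIdeator4.lean`
(crux `…Theses.PercLowPointHalfSpace.TallClusterMassBound`, item B of route PercLowPointHalfSpace), continuing
`…ArrowOneLogRatio.lean` (`mass_le_typicalMax_mul_log_ratio`) and `…ArrowOneVolRad.lean`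
(`tallClusterMassBound_of_squareSubharmonic_of_volRad`).

Hutchcroft's ROOTED sub-multiplicativity `P(|K_u ∩ Λ| ≥ (2N+1)t) ≤ P(|K_u ∩ Λ| ≥ t) · P(|K_max(Λ)| ≥ t)^N`
(`prodBernoulli_real_clusterCapIn_ge_mul_le`, Hutchcroft 2021 Thm 2.3 (2.7)) holds at EVERY integer threshold `t ≥ 1`,
and for `t ≥ M = typicalMax P^ℍ_p Λ_r` its second factor is `≤ P(|K_max(Λ_r)| ≥ M)^N ≤ e^{-N}`. Hence the whole of
ARROW 1 goes through with `t` in place of `M` (`P^ℍ_p = floorDilutedPercolation 3 p 1`, `Λ_r = halfBox r`,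
`π = π_p(r)`, `q_t := P^ℍ_p(|K_0 ∩ Λ_r| ≥ t)`):

* `real_mul_threshold_le_clusterCapIn_le` — `P^ℍ_p(|K_0 ∩ Λ_r| ≥ (2N+1)t) ≤ e^{-N} q_t` (`t ≥ M`);
* `real_clusterCapIn_ge_le_exp_mul_threshold` — `P^ℍ_p(|K_0 ∩ Λ_r| ≥ n) ≤ e^{3/2} (e^{-1/(2t)})^n q_t` (`n ≥ t ≥ M`);
* `sum_Ico_real_clusterCapIn_ge_le_mul_threshold` — `Σ_{n > T} P^ℍ_p(|K_0 ∩ Λ_r| ≥ n) ≤ e^{3/2} (e^{-1/(2t)})^T (1+2t) q_t`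
  (`T ≥ t ≥ M`);
* `mass_le_threshold_mul_log_ratio` — **ARROW 1 at threshold `t ≥ M`, every `p`**:
  `M_p(r) ≤ (2 + 3e^{3/2}) · t · π · (1 + log⁺(q_t/π))` (layer cake cut at `T = t + ⌈2t log⁺(q_t/π)⌉`);
* `massBoundAt_of_typicalMax_le_of_wallVolRad` — at `p_c`: `typicalMax P^ℍ_{p_c} Λ_r ≤ C r^s` and the `typicalMax`-FREE
  wall volume/radius inequality `P^ℍ_{p_c}(|C_ℍ(0)| ≥ ⌈c r^s⌉) ≤ K_c π_{p_c}(r)` (every `c > 0`, all `r ≥ 1`) give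
  `MassBoundAt p_c s` with the SAME exponent (`t = ⌈max(C,1) r^s⌉ ≥ typicalMax`, `q_t ≤ P^ℍ(|C_ℍ(0)| ≥ t) ≤ K π`;
  for `s < 0` the first hypothesis contradicts `typicalMax ≥ 2`);
* `tallClusterMassBound_of_squareSubharmonic_of_wallVolRad` — **B ⟸ `SquareSubharmonic` (stmt-CriticalPhenomena-11506,
  verbatim) ∧ the wall volume/radius inequality at the exponent `11/4`** (`SquareSubharmonic` gives
  `typicalMax ≤ C' r^{11/4}` exactly: `tau_criticalProbI_le_of_subharmonicPower` at `s = 2`, ball sums at rate `a = 1/2`,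
  ENGINE 4).
No definitions; no criticality enters §1–§2.
-/

noncomputable section

open MeasureTheory Finset Filter
open Literature.Probability.Percolation Literature.Probability.LatticeModels
open Summit.CriticalPhenomena.PercolationContinuityZ3.Theses.PercLowPointHalfSpace (TallClusterMassBound)
open Summit.CriticalPhenomena.PercolationContinuityZ3.Theses.PercSubharmonicSquare (SquareSubharmonic)
open Summit.CriticalPhenomena.PercolationContinuityZ3.Theorems.TallClusterMassBound.Negative

namespace Summit.CriticalPhenomena.PercolationContinuityZ3.Theorems.TallClusterMassBound.TightnessLine

/-! ## §1 Rooted universal tightness at any threshold `t ≥ typicalMax` -/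

/-- **Rooted sub-multiplicativity at a threshold `t ≥ M = typicalMax P^ℍ_p Λ_r`**:
`P^ℍ_p(|K_0 ∩ Λ_r| ≥ (2N+1)t) ≤ e^{-N} · P^ℍ_p(|K_0 ∩ Λ_r| ≥ t)` (Hutchcroft 2021, Thm 2.3 (2.7), tree
`prodBernoulli_real_clusterCapIn_ge_mul_le` at the integer threshold `t ≥ 1`, and
`P(|K_max(Λ_r)| ≥ t) ≤ P(|K_max(Λ_r)| ≥ M) ≤ e^{-1}`). [folklore] -/
theorem real_mul_threshold_le_clusterCapIn_le (p : unitInterval) {r t : ℕ}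
    (ht : typicalMax (floorDilutedPercolation 3 p 1) (halfBox r) ≤ t) (N : ℕ) :
    (floorDilutedPercolation 3 p 1).real {ω | (2 * N + 1) * t ≤ clusterCapIn (halfBox r) ω 0} ≤
      Real.exp (-(N : ℝ)) * (floorDilutedPercolation 3 p 1).real {ω | t ≤ clusterCapIn (halfBox r) ω 0} := by
  have hμ : floorDilutedPercolation 3 p 1 = prodBernoulli (floorDilutedParam 3 p 1) := rfl
  rw [hμ] at ht ⊢
  set μ := prodBernoulli (floorDilutedParam 3 p 1) with hμdef
  set M := typicalMax μ (halfBox r) with hMdef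
  have hM2 : 2 ≤ M := two_le_typicalMax μ (halfBox_nonempty r)
  have ht1 : 1 ≤ t := le_trans (by omega) ht
  refine (prodBernoulli_real_clusterCapIn_ge_mul_le (floorDilutedParam 3 p 1) (halfBox r) (0 : V3)
    (N := N) ht1).trans ?_
  rw [mul_comm]
  refine mul_le_mul_of_nonneg_right ?_ measureReal_nonneg
  have hmono : μ.real {ω | t ≤ clusterMaxIn (halfBox r) ω} ≤ μ.real {ω | M ≤ clusterMaxIn (halfBox r) ω} :=
    measureReal_mono (fun ω hω => le_trans ht hω) (measure_ne_top _ _)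
  calc μ.real {ω | t ≤ clusterMaxIn (halfBox r) ω} ^ N ≤ Real.exp (-1) ^ N :=
        pow_le_pow_left₀ measureReal_nonneg (hmono.trans (real_typicalMax_le_clusterMaxIn_le μ (halfBox r))) _
    _ = Real.exp (-(N : ℝ)) := by rw [← Real.exp_nat_mul]; congr 1; ring

/-- **Rooted universal tightness at threshold `t`, exponential form**: for `n ≥ t ≥ M = typicalMax P^ℍ_p Λ_r`,
`P^ℍ_p(|K_0 ∩ Λ_r| ≥ n) ≤ e^{3/2} (e^{-1/(2t)})^n · P^ℍ_p(|K_0 ∩ Λ_r| ≥ t)` (`N = ⌊(n/t - 1)/2⌋`: `(2N+1)t ≤ n` and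
`N > n/(2t) - 3/2`; Hutchcroft 2021, Thm 2.2 (2.5) with `M ↦ t`). [folklore] -/
theorem real_clusterCapIn_ge_le_exp_mul_threshold (p : unitInterval) {r t n : ℕ}
    (ht : typicalMax (floorDilutedPercolation 3 p 1) (halfBox r) ≤ t) (hn : t ≤ n) :
    (floorDilutedPercolation 3 p 1).real {ω | n ≤ clusterCapIn (halfBox r) ω 0} ≤
      Real.exp (3 / 2) * Real.exp (-1 / (2 * (t : ℝ))) ^ n *
        (floorDilutedPercolation 3 p 1).real {ω | t ≤ clusterCapIn (halfBox r) ω 0} := by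
  set μ := floorDilutedPercolation 3 p 1 with hμ
  have hM2 : 2 ≤ typicalMax μ (halfBox r) := two_le_typicalMax μ (halfBox_nonempty r)
  have ht0 : (0 : ℝ) < t := by exact_mod_cast (show 0 < t by omega)
  have hα : (1 : ℝ) ≤ n / t := by
    rw [le_div_iff₀ ht0, one_mul]
    exact_mod_cast hn
  set N := ⌊((n : ℝ) / t - 1) / 2⌋₊ with hN
  have hN1 : (2 * N + 1 : ℝ) ≤ n / t := by
    have := Nat.floor_le (show 0 ≤ ((n : ℝ) / t - 1) / 2 by linarith)
    rw [← hN] at this; linarith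
  have hN2 : ((n : ℝ) / t - 1) / 2 < N + 1 := by
    have := Nat.lt_floor_add_one (((n : ℝ) / t - 1) / 2)
    rw [← hN] at this; exact_mod_cast this
  have hsub : {ω : BondConfig V3 | n ≤ clusterCapIn (halfBox r) ω 0} ⊆
      {ω | (2 * N + 1) * t ≤ clusterCapIn (halfBox r) ω 0} := by
    intro ω hω
    simp only [Set.mem_setOf_eq] at hω ⊢
    have h1 : (((2 * N + 1) * t : ℕ) : ℝ) ≤ (n : ℝ) := by
      push_cast
      calc (2 * (N : ℝ) + 1) * t ≤ (n : ℝ) / t * t := mul_le_mul_of_nonneg_right hN1 ht0.le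
        _ = n := div_mul_cancel₀ _ ht0.ne'
    exact le_trans (by exact_mod_cast h1) hω
  have hexp : Real.exp (-(N : ℝ)) ≤ Real.exp (3 / 2) * Real.exp (-1 / (2 * (t : ℝ))) ^ n := by
    rw [← Real.exp_nat_mul, ← Real.exp_add]
    refine Real.exp_le_exp.2 ?_
    have : (n : ℝ) * (-1 / (2 * t)) = -(1 / 2) * (n / t) := by ring
    rw [this]
    linarith
  calc μ.real {ω | n ≤ clusterCapIn (halfBox r) ω 0}
      ≤ μ.real {ω | (2 * N + 1) * t ≤ clusterCapIn (halfBox r) ω 0} := measureReal_mono hsub (measure_ne_top _ _)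
    _ ≤ Real.exp (-(N : ℝ)) * μ.real {ω | t ≤ clusterCapIn (halfBox r) ω 0} :=
        real_mul_threshold_le_clusterCapIn_le p ht N
    _ ≤ Real.exp (3 / 2) * Real.exp (-1 / (2 * (t : ℝ))) ^ n * μ.real {ω | t ≤ clusterCapIn (halfBox r) ω 0} :=
        mul_le_mul_of_nonneg_right hexp measureReal_nonneg

/-- **Geometric tail at threshold `t`**: for `T ≥ t ≥ M = typicalMax P^ℍ_p Λ_r`,
`Σ_{n = T+1}^{|Λ_r|} P^ℍ_p(|K_0 ∩ Λ_r| ≥ n) ≤ e^{3/2} (e^{-1/(2t)})^T (1 + 2t) · P^ℍ_p(|K_0 ∩ Λ_r| ≥ t)`. [folklore] -/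
theorem sum_Ico_real_clusterCapIn_ge_le_mul_threshold (p : unitInterval) (r : ℕ) {t T : ℕ}
    (ht : typicalMax (floorDilutedPercolation 3 p 1) (halfBox r) ≤ t) (hT : t ≤ T) :
    ∑ n ∈ Finset.Ico (T + 1) ((halfBox r).card + 1),
        (floorDilutedPercolation 3 p 1).real {ω | n ≤ clusterCapIn (halfBox r) ω 0} ≤
      Real.exp (3 / 2) * Real.exp (-1 / (2 * (t : ℝ))) ^ T * (1 + 2 * (t : ℝ)) *
        (floorDilutedPercolation 3 p 1).real {ω | t ≤ clusterCapIn (halfBox r) ω 0} := by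
  set μ := floorDilutedPercolation 3 p 1 with hμ
  set q := μ.real {ω | t ≤ clusterCapIn (halfBox r) ω 0} with hqdef
  have hq0 : 0 ≤ q := measureReal_nonneg
  have hM2 : 2 ≤ typicalMax μ (halfBox r) := two_le_typicalMax μ (halfBox_nonempty r)
  have ht0 : (0 : ℝ) < t := by exact_mod_cast (show 0 < t by omega)
  set ρ := Real.exp (-1 / (2 * (t : ℝ))) with hρ
  have hρ0 : 0 ≤ ρ := (Real.exp_pos _).le
  have hρ1 : ρ < 1 := Real.exp_lt_one_iff.2 (by
    rw [neg_div]
    exact neg_neg_of_pos (by positivity))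
  have hterm : ∀ n ∈ Finset.Ico (T + 1) ((halfBox r).card + 1),
      μ.real {ω | n ≤ clusterCapIn (halfBox r) ω 0} ≤ Real.exp (3 / 2) * ρ ^ n * q := by
    intro n hn
    have htn : t ≤ n := by
      have := (Finset.mem_Ico.1 hn).1
      omega
    exact real_clusterCapIn_ge_le_exp_mul_threshold p ht htn
  have hgeom : ∑ n ∈ Finset.Ico (T + 1) ((halfBox r).card + 1), ρ ^ n ≤ ρ ^ T * (1 + 2 * (t : ℝ)) :=
    geom_sum_Ico_succ_le_pow_mul hρ0 hρ1 (one_div_one_sub_exp_le ht0) T _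
  calc ∑ n ∈ Finset.Ico (T + 1) ((halfBox r).card + 1), μ.real {ω | n ≤ clusterCapIn (halfBox r) ω 0}
      ≤ ∑ n ∈ Finset.Ico (T + 1) ((halfBox r).card + 1), Real.exp (3 / 2) * ρ ^ n * q :=
        Finset.sum_le_sum hterm
    _ = Real.exp (3 / 2) * (∑ n ∈ Finset.Ico (T + 1) ((halfBox r).card + 1), ρ ^ n) * q := by
        rw [Finset.mul_sum, Finset.sum_mul]
    _ ≤ Real.exp (3 / 2) * (ρ ^ T * (1 + 2 * (t : ℝ))) * q :=
        mul_le_mul_of_nonneg_right (mul_le_mul_of_nonneg_left hgeom (Real.exp_pos _).le) hq0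
    _ = Real.exp (3 / 2) * ρ ^ T * (1 + 2 * (t : ℝ)) * q := by ring

/-! ## §2 ARROW 1 at threshold `t` -/

/-- **ARROW 1 at every `p`, at any threshold `t ≥ typicalMax P^ℍ_p Λ_r`**:
`M_p(r) ≤ (2 + 3e^{3/2}) · t · π_p(r) · (1 + log⁺(q_t/π_p(r)))`, `q_t = P^ℍ_p(|K_0 ∩ Λ_r| ≥ t)` (layer cake
`sum_real_conn_inter_arm_le` cut at `T = t + ⌈2t log⁺(q_t/π)⌉`, geometric tail `e^{3/2} e^{-T/(2t)} (1+2t) q_t ≤ e^{3/2} (1+2t) π`;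
for `q_t ≤ π` there is no logarithm at all). [folklore] -/
theorem mass_le_threshold_mul_log_ratio :
    ∀ (p : unitInterval) (r t : ℕ), typicalMax (floorDilutedPercolation 3 p 1) (halfBox r) ≤ t → mass p r ≤ (2 + 3 * Real.exp (3 / 2)) * (t : ℝ) * armProb p r * (1 + max 0 (Real.log ((floorDilutedPercolation 3 p 1).real {ω | t ≤ clusterCapIn (halfBox r) ω 0} / armProb p r))) := by
  intro p r t ht
  have hmass : mass p r = ∑ x ∈ box 3 r, (floorDilutedPercolation 3 p 1).real (conn x ∩ arm r) := by
    unfold mass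
    exact Finset.sum_congr rfl fun x _ => real_conn_inter_arm_eq_floorDiluted p x r
  rw [hmass, armProb_eq_floorDiluted p r]
  set μ := floorDilutedPercolation 3 p 1 with hμ
  set π := μ.real (arm r) with hπdef
  set q := μ.real {ω | t ≤ clusterCapIn (halfBox r) ω 0} with hqdef
  set E := Real.exp (3 / 2) with hE
  have hE0 : 0 < E := Real.exp_pos _
  have hM2 : 2 ≤ typicalMax μ (halfBox r) := two_le_typicalMax μ (halfBox_nonempty r)
  have htR : (2 : ℝ) ≤ t := by exact_mod_cast (le_trans hM2 ht)
  have ht0 : (0 : ℝ) < t := by linarith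
  have hπ0 : 0 ≤ π := measureReal_nonneg
  have hq0 : 0 ≤ q := measureReal_nonneg
  rcases hπ0.eq_or_lt with hπz | hπpos
  · -- `π = 0`: both sides vanish
    have hle : ∑ x ∈ box 3 r, μ.real (conn x ∩ arm r) ≤ 0 := by
      calc ∑ x ∈ box 3 r, μ.real (conn x ∩ arm r) ≤ ∑ _x ∈ box 3 r, π :=
            Finset.sum_le_sum fun x _ => measureReal_mono Set.inter_subset_right (measure_ne_top _ _)
        _ = 0 := by rw [← hπz, Finset.sum_const_zero]
    have hrhs : (2 + 3 * E) * (t : ℝ) * π * (1 + max 0 (Real.log (q / π))) = 0 := by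
      rw [← hπz]; ring
    linarith
  · -- `π > 0`
    set L := max 0 (Real.log (q / π)) with hL
    have hL0 : 0 ≤ L := le_max_left _ _
    set T := t + ⌈2 * (t : ℝ) * L⌉₊ with hT
    have hTt : t ≤ T := Nat.le_add_right _ _
    have hTle : (T : ℝ) ≤ t + 2 * t * L + 1 := by
      have := Nat.ceil_lt_add_one (show 0 ≤ 2 * (t : ℝ) * L by positivity)
      rw [hT]; push_cast; linarith
    have hTge : 2 * (t : ℝ) * L ≤ T := by
      have := Nat.le_ceil (2 * (t : ℝ) * L)
      rw [hT]; push_cast; linarith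
    -- the geometric factor is at most `exp (-L)`
    have hρT : Real.exp (-1 / (2 * (t : ℝ))) ^ T ≤ Real.exp (-L) := by
      rw [← Real.exp_nat_mul]
      refine Real.exp_le_exp.2 ?_
      have : (T : ℝ) * (-1 / (2 * t)) = -(T / (2 * t)) := by ring
      rw [this, neg_le_neg_iff, le_div_iff₀ (by positivity)]
      linarith
    -- and `q · exp(-L) ≤ π`
    have hqL : q * Real.exp (-L) ≤ π := by
      rcases le_or_gt q π with hqπ | hqπ
      · calc q * Real.exp (-L) ≤ q * 1 := by
              refine mul_le_mul_of_nonneg_left ?_ hq0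
              rw [Real.exp_le_one_iff]
              linarith
          _ ≤ π := by rw [mul_one]; exact hqπ
      · have hqpos : 0 < q := hπpos.trans hqπ
        have hqne : q ≠ 0 := hqpos.ne'
        have hle1 : 1 ≤ q / π := by
          rw [le_div_iff₀ hπpos, one_mul]
          exact hqπ.le
        have hLeq : L = Real.log (q / π) := max_eq_right (Real.log_nonneg hle1)
        rw [hLeq, Real.exp_neg, Real.exp_log (div_pos hqpos hπpos), inv_div, mul_div_assoc',
          mul_div_cancel_left₀ _ hqne]
    have step1 := sum_real_conn_inter_arm_le p r T
    have step2 := sum_Ico_real_clusterCapIn_ge_le_mul_threshold p r ht hTt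
    have htail : ∑ n ∈ Finset.Ico (T + 1) ((halfBox r).card + 1),
        μ.real {ω | n ≤ clusterCapIn (halfBox r) ω 0} ≤ E * π * (1 + 2 * t) := by
      refine step2.trans ?_
      have h1 : 0 ≤ E * (1 + 2 * (t : ℝ)) := by positivity
      calc E * Real.exp (-1 / (2 * (t : ℝ))) ^ T * (1 + 2 * (t : ℝ)) * q
          = E * (1 + 2 * (t : ℝ)) * (Real.exp (-1 / (2 * (t : ℝ))) ^ T * q) := by ring
        _ ≤ E * (1 + 2 * (t : ℝ)) * (Real.exp (-L) * q) :=
            mul_le_mul_of_nonneg_left (mul_le_mul_of_nonneg_right hρT hq0) h1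
        _ ≤ E * (1 + 2 * (t : ℝ)) * π := by
            rw [mul_comm (Real.exp (-L)) q]
            exact mul_le_mul_of_nonneg_left hqL h1
        _ = E * π * (1 + 2 * t) := by ring
    have hmain : ∑ x ∈ box 3 r, μ.real (conn x ∩ arm r) ≤
        (t + 2 * t * L + 1) * π + E * π * (1 + 2 * t) := by
      refine step1.trans (add_le_add ?_ htail)
      exact mul_le_mul_of_nonneg_right hTle hπ0
    have key : (2 + 3 * E) * (t : ℝ) * π * (1 + L) - ((t + 2 * t * L + 1) * π + E * π * (1 + 2 * t)) =
        π * ((t - 1) * (1 + E) + 3 * E * t * L) := by ring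
    have hnonneg : 0 ≤ π * (((t : ℝ) - 1) * (1 + E) + 3 * E * t * L) := by
      have h1 : (0 : ℝ) ≤ (t - 1) * (1 + E) := mul_nonneg (by linarith) (by linarith)
      have h2 : (0 : ℝ) ≤ 3 * E * t * L := by positivity
      exact mul_nonneg hπ0 (add_nonneg h1 h2)
    linarith

/-! ## §3 At `p_c`: a `typicalMax`-free wall volume/radius inequality removes the logarithm -/

/-- **No-loss arithmetic, threshold form**: `typicalMax P^ℍ_{p_c} Λ_r ≤ C r^s` (all `r ≥ 1`) and, for every `c > 0`, a
constant `K_c` with `P^ℍ_{p_c}(|C_ℍ(0)| ≥ ⌈c r^s⌉) ≤ K_c · π_{p_c}(r)` (all `r ≥ 1`) give `MassBoundAt p_c s` with the SAME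
exponent `s`: ARROW 1 at the threshold `t = ⌈max(C,1) r^s⌉ ≥ typicalMax` (`mass_le_threshold_mul_log_ratio`), where
`q_t ≤ P^ℍ(|C_ℍ(0)| ≥ t) ≤ K π` (`real_le_clusterCapIn_le_real_clusterSizeGe`) bounds the logarithm by `log⁺ K` and
`t ≤ (max(C,1) + 1) r^s`; for `s < 0` the first hypothesis is void (`typicalMax ≥ 2 > C r^s` for large `r`). [folklore] -/
theorem massBoundAt_of_typicalMax_le_of_wallVolRad :
    ∀ (s C : ℝ), (∀ r : ℕ, 1 ≤ r → (typicalMax (floorDilutedPercolation 3 (criticalProbI 3) 1) (halfBox r) : ℝ) ≤ C * (r : ℝ) ^ s) → (∀ c : ℝ, 0 < c → ∃ K : ℝ, ∀ r : ℕ, 1 ≤ r → (floorDilutedPercolation 3 (criticalProbI 3) 1).real (clusterSizeGe (0 : V3) ⌈c * (r : ℝ) ^ s⌉₊) ≤ K * armProb (criticalProbI 3) r) → MassBoundAt (criticalProbI 3) s := by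
  intro s C hM hV
  set c₀ : ℝ := max C 1 with hc₀
  have hc₀1 : 1 ≤ c₀ := le_max_right _ _
  have hc₀0 : 0 < c₀ := by linarith
  obtain ⟨K, hK⟩ := hV c₀ hc₀0
  -- the exponent is nonnegative: for `s < 0` the first hypothesis contradicts `typicalMax ≥ 2`
  have hs : 0 ≤ s := by
    by_contra hs'
    have hs : 0 < -s := by linarith [not_le.1 hs']
    obtain ⟨r, hr1, hr⟩ := exists_nat_lt_rpow C hs
    have hr0 : (0 : ℝ) < r := by exact_mod_cast hr1
    have hrs : 0 < (r : ℝ) ^ s := Real.rpow_pos_of_pos hr0 s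
    have h2 : (2 : ℝ) ≤ typicalMax (floorDilutedPercolation 3 (criticalProbI 3) 1) (halfBox r) := by
      exact_mod_cast two_le_typicalMax _ (halfBox_nonempty r)
    have h3 : C * (r : ℝ) ^ s < 1 := by
      calc C * (r : ℝ) ^ s < (r : ℝ) ^ (-s) * (r : ℝ) ^ s := mul_lt_mul_of_pos_right hr hrs
        _ = 1 := by rw [Real.rpow_neg hr0.le, inv_mul_cancel₀ hrs.ne']
    linarith [hM r hr1]
  refine ⟨(2 + 3 * Real.exp (3 / 2)) * (1 + max 0 (Real.log K)) * (c₀ + 1), fun r hr => ?_⟩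
  set μ := floorDilutedPercolation 3 (criticalProbI 3) 1 with hμ
  set π := armProb (criticalProbI 3) r with hπdef
  have hπ : 0 < π := armProb_criticalProbI_pos r
  have hr1 : (1 : ℝ) ≤ r := by exact_mod_cast hr
  have hrs1 : 1 ≤ (r : ℝ) ^ s := Real.one_le_rpow hr1 hs
  have hrs : 0 ≤ (r : ℝ) ^ s := by linarith
  have hct0 : 0 ≤ c₀ * (r : ℝ) ^ s := by positivity
  set t := ⌈c₀ * (r : ℝ) ^ s⌉₊ with htdef
  have hMt : typicalMax μ (halfBox r) ≤ t := by
    have h1 : (typicalMax μ (halfBox r) : ℝ) ≤ c₀ * (r : ℝ) ^ s :=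
      (hM r hr).trans (mul_le_mul_of_nonneg_right (le_max_left _ _) hrs)
    have h2 : (typicalMax μ (halfBox r) : ℝ) ≤ (t : ℝ) := h1.trans (Nat.le_ceil _)
    exact_mod_cast h2
  have htle : (t : ℝ) ≤ (c₀ + 1) * (r : ℝ) ^ s := by
    have := Nat.ceil_lt_add_one hct0
    rw [← htdef] at this
    calc (t : ℝ) ≤ c₀ * (r : ℝ) ^ s + 1 := this.le
      _ ≤ c₀ * (r : ℝ) ^ s + (r : ℝ) ^ s := by linarith
      _ = (c₀ + 1) * (r : ℝ) ^ s := by ring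
  set q := μ.real {ω | t ≤ clusterCapIn (halfBox r) ω 0} with hqdef
  have hq0 : 0 ≤ q := measureReal_nonneg
  have hqK : q ≤ K * π := (real_le_clusterCapIn_le_real_clusterSizeGe (criticalProbI 3) r t).trans (hK r hr)
  have hratio : q / π ≤ K := by
    rw [div_le_iff₀ hπ]
    exact hqK
  have hlog : max 0 (Real.log (q / π)) ≤ max 0 (Real.log K) :=
    Real.posLog_le_posLog (div_nonneg hq0 hπ.le) hratio
  have hL0 : 0 ≤ max 0 (Real.log K) := le_max_left _ _
  have ht0 : (0 : ℝ) ≤ t := Nat.cast_nonneg _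
  calc mass (criticalProbI 3) r
      ≤ (2 + 3 * Real.exp (3 / 2)) * (t : ℝ) * π * (1 + max 0 (Real.log (q / π))) :=
        mass_le_threshold_mul_log_ratio (criticalProbI 3) r t hMt
    _ ≤ (2 + 3 * Real.exp (3 / 2)) * (t : ℝ) * π * (1 + max 0 (Real.log K)) := by gcongr
    _ = (2 + 3 * Real.exp (3 / 2)) * (1 + max 0 (Real.log K)) * t * π := by ring
    _ ≤ (2 + 3 * Real.exp (3 / 2)) * (1 + max 0 (Real.log K)) * ((c₀ + 1) * (r : ℝ) ^ s) * π := by gcongr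
    _ = (2 + 3 * Real.exp (3 / 2)) * (1 + max 0 (Real.log K)) * (c₀ + 1) * (r : ℝ) ^ s * π := by ring

/-- **B ⟸ `SquareSubharmonic` (stmt-CriticalPhenomena-11506, verbatim) ∧ the `typicalMax`-free wall volume/radius
inequality `∀ c > 0, ∃ K, ∀ r ≥ 1, P^ℍ_{p_c}(|C_ℍ(0)| ≥ ⌈c r^{11/4}⌉) ≤ K · π_{p_c}(r)`**: `SquareSubharmonic` gives
`typicalMax P^ℍ_{p_c} Λ_r ≤ C' r^{11/4}` exactly (`tau_criticalProbI_le_of_subharmonicPower` at `s = 2`, ball sums at rate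
`a = 1/2`, ENGINE 4 `typicalMax_le_of_ballTwoPointDecay`), and `massBoundAt_of_typicalMax_le_of_wallVolRad` removes the
logarithm of ARROW 1. [folklore] -/
theorem tallClusterMassBound_of_squareSubharmonic_of_wallVolRad :
    Summit.CriticalPhenomena.PercolationContinuityZ3.Theses.PercSubharmonicSquare.SquareSubharmonic → (∀ c : ℝ, 0 < c → ∃ K : ℝ, ∀ r : ℕ, 1 ≤ r → (floorDilutedPercolation 3 (criticalProbI 3) 1).real (clusterSizeGe (0 : V3) ⌈c * (r : ℝ) ^ ((11 : ℝ) / 4)⌉₊) ≤ K * armProb (criticalProbI 3) r) → Summit.CriticalPhenomena.PercolationContinuityZ3.Theses.PercLowPointHalfSpace.TallClusterMassBound := by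
  intro h hV
  obtain ⟨R, hR⟩ := h
  -- `SquareSubharmonic` is sub-mean-value of `τ_p^s` with the real exponent `s = 2`
  have hsub : ∀ p : unitInterval, (p : ℝ) < criticalProb (zdGraph 3) (0 : Site 3) →
      ∀ x : Site 3, (R : ℝ) < ‖x‖ →
        tau 3 p 0 x ^ (2 : ℝ) ≤
          (1 / 6 : ℝ) * ∑ i : Fin 3, (tau 3 p 0 (x + Pi.single i 1) ^ (2 : ℝ) + tau 3 p 0 (x - Pi.single i 1) ^ (2 : ℝ)) := by
    intro p hp x hx
    simpa only [Real.rpow_two] using hR p hp x hx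
  obtain ⟨C, hC0, hC⟩ := tau_criticalProbI_le_of_subharmonicPower (s := 2) (by norm_num) hsub
  have hpt : ∀ x : Site 3, x ≠ 0 → tau 3 (criticalProbI 3) 0 x ≤ C * ‖x‖ ^ (-((1 : ℝ) / 2)) := by
    intro x hx
    simpa using hC x hx
  have hball := ballSum_le_of_pointwise (a := 1 / 2) (by norm_num) hC0.le hpt
  obtain ⟨C', hC'⟩ := typicalMax_le_of_ballTwoPointDecay (a := 1 / 2) (by norm_num) hball
  refine tallClusterMassBound_iff.2 (massBoundAt_of_typicalMax_le_of_wallVolRad ((11 : ℝ) / 4) C' ?_ hV)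
  intro r hr
  have e : ((6 : ℝ) - 1 / 2) / 2 = (11 : ℝ) / 4 := by norm_num
  rw [← e]
  exact hC' r hr

end Summit.CriticalPhenomena.PercolationContinuityZ3.Theorems.TallClusterMassBound.TightnessLine

end
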